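import Summits.MatrixMultiplication.OmegaCensus.STPPCosetQuotientKillN46

/-!
# ω-census (abelian STPP census): `{(2,3,4),(2,3,4)}` has no STPP realisation in any abelian group of order `46`; order `46` is conditional on ONE pattern (kernel)

HONEST FRAMING (pub-omega census; verbatim): lottery ticket; floor = certified bounds/negative ranges.
Census EXCLUSION (seat pub-omega-stpp-2 gen 31, 2026-08-29), family (b2).  Same mechanism as `STPPCosetQuotientKillN46.lean` (full-coset quotient word + one
Kneser step): order `46 = 2·23`, pattern `{(2,3,4),(2,3,4)}`; reading `(B,A,C)` at blocks `0` and `1` pins the outer Kneser stabilizer to order `2` and makes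
`A₀ = a + K`, `A₁ = a′ + K` cosets of THE order-2 subgroup `K`; the TPP words of the two blocks (second term from `K = Aᵢ − Aᵢ`) make `(C₀ − B₀) + K` and
`(C₁ − B₁) + K` sets of `24` elements; `kLB(24, 24, d) ≥ 46` for every `d ∣ 46` ⇒ `((C₀ − B₀) + K) − ((C₁ − B₁) + K) = H ∋ 0`, i.e. the Def-5.1 word
`a₀ − a₀′ + b₁ − b₀ + c₀ − c₁` (tree indices `(0,1,0)`) vanishes — contradiction.  (In `H/K ≅ ℤ₂₃`: `|C̄₀ − B̄₀| + |C̄₁ − B̄₁| − 1 = 23`.)  With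
`…KillN46.lean`: **every abelian group of order `46` (i.e. `ℤ₄₆`) admits no beating STPP family unless `{(2,2,3),(3,3,2),(3,3,2)}` is realisable**
(`volume_le_of_card_eq_46_of_not_realizable_223_332_332`).  Nothing here is progress on `ω`.

References: M. Kneser, Math. Z. 58 (1953); H. Cohn, R. Kleinberg, B. Szegedy, C. Umans, FOCS 2005 (arXiv:math/0511460), Def. 5.1.
-/

open Finset
open scoped Pointwise

namespace Summit.MatrixMultiplication.OmegaCensus.CubeNB

open Literature.Computability.AlgebraicComplexity
open Literature.Combinatorics.Additive
open Summit.MatrixMultiplication.OmegaCensus.STPPKneser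

variable {H : Type*} [AddCommGroup H] [DecidableEq H] [Fintype H]

/-- **`{(2,3,4),(2,3,4)}` has no STPP realisation in any abelian group of order `46`.** [cite: Kneser1953] [cite: CohnKleinbergSzegedyUmans2005, Def. 5.1] -/
theorem no_isSTPP_card46_234_234 (hH : Fintype.card H = 46) (A B C : Fin 2 → Finset H) (hS : IsSTPP A B C)
    (hA : ∀ i, #(A i) = ![2, 2] i) (hB : ∀ i, #(B i) = ![3, 3] i) (hC : ∀ i, #(C i) = ![4, 4] i) : False := by
  have hAne : ∀ i, (A i).Nonempty := fun i => card_pos.1 (by rw [hA]; fin_cases i <;> simp)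
  have hBne : ∀ i, (B i).Nonempty := fun i => card_pos.1 (by rw [hB]; fin_cases i <;> simp)
  have hCne : ∀ i, (C i).Nonempty := fun i => card_pos.1 (by rw [hC]; fin_cases i <;> simp)
  obtain ⟨K1, hK1, hK1q, t1, -, hs1⟩ := exists_carrier_middle_subset_coset' (stpp_rotate (isSTPP_neg_reverse hS)) (nonempty_neg_family hBne)
    (nonempty_neg_family hAne) (nonempty_neg_family hCne) 0 ⟨1, by decide⟩ (n := 46) (q := 2) (z := 12) (b := 2) (vol := 24) (a := 3) (L := 8) hH
    (by simp only [Finset.card_neg, hB]; decide) (by simp only [Finset.card_neg, hA]; decide) (by simp only [Finset.card_neg, hA, hB, hC]; decide)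
    (by simp only [Finset.card_neg, hB, hC]; decide) (by simp only [Finset.card_neg, hA, hC]; decide) (by decide)
  have hsub1 : A 0 ⊆ (-t1) +ᵥ K1 := subset_coset_of_neg_subset hK1 hs1
  obtain ⟨K2, hK2, hK2q, t2, -, hs2⟩ := exists_carrier_middle_subset_coset' (stpp_rotate (isSTPP_neg_reverse hS)) (nonempty_neg_family hBne)
    (nonempty_neg_family hAne) (nonempty_neg_family hCne) 1 ⟨0, by decide⟩ (n := 46) (q := 2) (z := 12) (b := 2) (vol := 24) (a := 3) (L := 8) hH
    (by simp only [Finset.card_neg, hB]; decide) (by simp only [Finset.card_neg, hA]; decide) (by simp only [Finset.card_neg, hA, hB, hC]; decide)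
    (by simp only [Finset.card_neg, hB, hC]; decide) (by simp only [Finset.card_neg, hA, hC]; decide) (by decide)
  have hsub2 : A 1 ⊆ (-t2) +ᵥ K2 := subset_coset_of_neg_subset hK2 hs2
  have hK : K1 = K2 := eq_of_card_eq_coprime hK1 hK2 (m := 23) hK1q hK2q (by rw [hH]) (by decide)
  subst hK
  set K := K1 with hKdef
  have hA0 : A 0 = (-t1) +ᵥ K := Finset.eq_of_subset_of_card_le hsub1 (by rw [Finset.card_vadd_finset, hK1q, hA]; decide)
  have hA1 : A 1 = (-t2) +ᵥ K := Finset.eq_of_subset_of_card_le hsub2 (by rw [Finset.card_vadd_finset, hK1q, hA]; decide)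
  have memA0 : ∀ k ∈ K, -t1 + k ∈ A 0 := fun k hk => by rw [hA0]; exact Finset.mem_vadd_finset.2 ⟨k, hk, rfl⟩
  have memA1 : ∀ k ∈ K, -t2 + k ∈ A 1 := fun k hk => by rw [hA1]; exact Finset.mem_vadd_finset.2 ⟨k, hk, rfl⟩
  have hKne : K.Nonempty := hK1.nonempty
  -- |(Cᵢ − Bᵢ) + K| = 24 for i = 0, 1 (TPP word of block i, second term from K = Aᵢ − Aᵢ)
  have hD : ∀ (i : Fin 2) (t : H), (∀ k ∈ K, -t + k ∈ A i) → #(D B C i + K) = 24 := by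
    intro i t memA
    have hBi : #(B i) = 3 := by rw [hB]; fin_cases i <;> rfl
    have hCi : #(C i) = 4 := by rw [hC]; fin_cases i <;> rfl
    rw [← Finset.image_add_product, Finset.card_image_of_injOn, Finset.card_product, card_D_BC hS hAne i, hBi, hCi, hK1q]
    rintro ⟨d, k⟩ hdk ⟨d', k'⟩ hdk' (h : d + k = d' + k')
    simp only [Finset.coe_product, Set.mem_prod, Finset.mem_coe] at hdk hdk'
    obtain ⟨b, hb, c, hc, rfl⟩ := mem_D.1 hdk.1
    obtain ⟨b', hb', c', hc', rfl⟩ := mem_D.1 hdk'.1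
    have hw : ((-t + k) - (-t + k')) + (b' - b) + (c - c') = 0 := by
      have : c - b + k - (c' - b' + k') = 0 := sub_eq_zero.2 h
      rw [← this]; abel
    obtain ⟨-, -, h1, h2, h3⟩ := hS i i i (-t + k') (memA k' hdk'.2) (-t + k) (memA k hdk.2) b hb b' hb' c' hc' c hc hw
    have hk : k' = k := by simpa using h1
    rw [h2, h3, hk]
  have hD0 := hD 0 t1 memA0
  have hD1 := hD 1 t2 memA1
  -- one Kneser step: ((C₀ − B₀) + K) − ((C₁ − B₁) + K) = H
  have hne0 : (D B C 0 + K).Nonempty := (D_nonempty (hBne 0) (hCne 0)).add hKne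
  have hne1 : (-(D B C 1 + K)).Nonempty := ((D_nonempty (hBne 1) (hCne 1)).add hKne).neg
  have hUge : 46 ≤ #((D B C 0 + K) + (-(D B C 1 + K))) := by
    obtain ⟨d, hd, hdvd, hk⟩ := exists_dvd_kneserLB_le_card_add (D B C 0 + K) (-(D B C 1 + K)) hne0 hne1
    rw [Finset.card_neg, hD0, hD1, hH] at *
    have hmem : d ∈ Nat.divisors 46 := Nat.mem_divisors.2 ⟨hdvd, by norm_num⟩
    exact le_trans ((by decide : ∀ d ∈ Nat.divisors 46, 46 ≤ kneserLB 24 24 d) d hmem) hk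
  have hU : (D B C 0 + K) + (-(D B C 1 + K)) = univ := Finset.eq_univ_of_card _ (le_antisymm (Finset.card_le_univ _) (hH ▸ hUge))
  -- 0 ∈ U unfolds to the word a₀ − a₀′ + b₁ − b₀ + c₀ − c₁ (tree indices (0,1,0))
  have hmem : (0 : H) ∈ (D B C 0 + K) + (-(D B C 1 + K)) := hU ▸ Finset.mem_univ _
  obtain ⟨x, hx, y, hy, hxy⟩ := Finset.mem_add.1 hmem
  obtain ⟨d0, hd0, k0, hk0, rfl⟩ := Finset.mem_add.1 hx
  obtain ⟨b0, hb0, c0, hc0, rfl⟩ := mem_D.1 hd0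
  rw [Finset.mem_neg] at hy
  obtain ⟨y', hy', hyy⟩ := hy
  obtain ⟨d1, hd1, k1, hk1, rfl⟩ := Finset.mem_add.1 hy'
  obtain ⟨b1, hb1, c1, hc1, rfl⟩ := mem_D.1 hd1
  have ha : -t1 + (k0 - k1) ∈ A 0 := memA0 _ (hK1.sub_mem hk0 hk1)
  have ha' : -t1 + 0 ∈ A 0 := memA0 0 hK1.zero_mem
  have hword : ((-t1 + (k0 - k1)) - (-t1 + 0)) + (b1 - b0) + (c0 - c1) = 0 := by
    have e : c0 - b0 + k0 + y = 0 := hxy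
    rw [← hyy] at e
    have : -t1 + (k0 - k1) - (-t1 + 0) + (b1 - b0) + (c0 - c1) = c0 - b0 + k0 + -(c1 - b1 + k1) := by abel
    rw [this, e]
  obtain ⟨h01, -⟩ := hS 0 1 0 (-t1 + 0) ha' (-t1 + (k0 - k1)) ha b0 hb0 b1 hb1 c1 hc1 c0 hc0 hword
  exact absurd h01 (by decide)

section Capstone

open Summit.MatrixMultiplication.OmegaCensus.KLister

/-- `234_234` is not realisable in any abelian group of order `46`. [cite: CohnKleinbergSzegedyUmans2005, Def. 5.1] -/
theorem notRealizable_card46_234_234 (hH : Fintype.card H = 46) : ¬ Realizable H ([(2, 3, 4), (2, 3, 4)] : List Shape) := by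
  intro h
  obtain ⟨A, B, C, hS, hc⟩ := h.out
  exact no_isSTPP_card46_234_234 hH A B C hS (fun i => by fin_cases i <;> exact (hc _).2.2.2.1)
    (fun i => by fin_cases i <;> exact (hc _).2.2.2.2.1) (fun i => by fin_cases i <;> exact (hc _).2.2.2.2.2)

end Capstone

end Summit.MatrixMultiplication.OmegaCensus.CubeNB

namespace Summit.MatrixMultiplication.OmegaCensus.KLister

open Literature.Computability.AlgebraicComplexity
open Summit.MatrixMultiplication.OmegaCensus.CubeNB

/-- **Order `46`: no beating STPP family unless `{(2,2,3),(3,3,2),(3,3,2)}` is realisable** (every other lister survivor discharged: `234_243`, `224_242_422`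
by N19, `234_324`, `234_234` by the coset-quotient kills). [cite: CohnKleinbergSzegedyUmans2005, Def. 5.1] -/
theorem volume_le_of_card_eq_46_of_not_realizable_223_332_332 {H : Type*} [AddCommGroup H] [Fintype H] [DecidableEq H] (hH : Fintype.card H = 46)
    (h223 : ¬ Realizable H ([(2, 2, 3), (3, 3, 2), (3, 3, 2)] : List Shape))
    {m : ℕ} (A B C : Fin m → Finset H) (hS : IsSTPP A B C) : ∑ i, #(A i) * #(B i) * #(C i) ≤ 46 := by
  refine volume_le_of_card_eq_46_of_dead_q hH ?_ A B C hS
  intro D hD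
  simp only [deadN46q, List.mem_cons, List.not_mem_nil, or_false] at hD
  rcases hD with rfl | rfl
  · exact notRealizable_card46_234_234 hH
  · exact h223

end Summit.MatrixMultiplication.OmegaCensus.KLister
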